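import Literature.NumberTheory.GaloisCohomology.Howard2004.FiniteSingularTame
import Literature.NumberTheory.GaloisCohomology.Howard2004.LevelQuotientProofs
import Literature.NumberTheory.GaloisRepresentations.DecompositionGroupOfCompletion
import Literature.NumberTheory.GaloisRepresentations.GaloisRepUnramifiedProofs
import HarnessLib

/-!
# Howard 2004, Def. 1.2.1 / 1.2.3: at a Kolyvagin prime `λ ∈ n`, `Γ_{K_λ}` acts trivially on
# `T/I_nT`, which is killed by `ℓ + 1`; hence the tame finite–singular slot is ADMISSIBLE
# under H.0 alone (theorems only)

Topic `NumberTheory/GaloisCohomology/Howard2004` (sequel to `FiniteSingularTame`; cell `pub/bsd-print-x9`,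
lit g32, obligation (n1)).  THEOREMS ONLY (no definition, no named fact, no instance, no `sorry`).

Howard, §1.2 [arXiv:1202.6340 p. 6, L57–75]: «`𝓛₀ = 𝓛₀(T)` the set of degree two primes of `K`
which do not divide `p` or any prime at which `T` is ramified … `I_ℓ` the smallest ideal of `R`
containing `ℓ + 1` for which `Frob_λ` acts trivially on `T/I_ℓT` … `G_ℓ = k_λˣ/k_ℓˣ` … `I_n = Σ I_ℓ`»;
these are exactly the standing hypotheses of Def. 1.1.8 («`v` does not divide `p`, `G_{K_v}` acts
trivially on `T`, and `|k_vˣ|·T = 0`») for the module `T/I_{n}T` at `λ ∈ n`, used in Def. 1.2.3.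
This file discharges them in the kernel for a `LevelData` presentation:

* `trivial_toLocal_of_mem_primes` (+ `_of_mem_level_of_h0`) — for `λ ∈ 𝓛`: if the Frobenius
  elements at `λ` act trivially on the presentation `N n` of `T/I_nT` (for `λ ∈ n`: the defining
  property of `I_ℓ ⊆ I_n`; tree `LevelData.ρq_apply_eq_self_of_h0` / `_of_free` /
  `_of_isDiscreteValuationRing`, file `LevelQuotientProofs`), then every `σ ∈ Γ_{K_λ}` does (inertia:
  `T/I_nT` unramified at `λ ∈ 𝓛₀`, tree `LevelData.isUnramifiedAt_of_mem_primes` +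
  `GaloisRep.isUnramifiedAt_iff_toLocal_holds`; a local Frobenius lift restricts to a Frobenius at `λ`,
  tree `isArithFrobAt_absGaloisRestrict_adicCompletionPrime_iff`; `I_{K_λ}·⟨Frob⟩` is dense and
  stabilisers are closed);
* `residueFieldCard_sub_one_smul_eq_zero_of_mem_level` — `(q_λ − 1)·(T/I_nT) = 0` (`q_λ = ℓ²`, tree
  `LevelData.residueChar_sq_sub_one_nsmul_eq_zero`); `natCard_gell_smul_eq_zero_of_mem_level` —
  `#G_ℓ·(T/I_nT) = 0` (`#G_ℓ = ℓ + 1`); `tameHyp_of_mem_level`;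
* **`LevelData.isFsAdmissible_of_fs_eq_tameSlot_of_frob`** / **`…_of_h0`** / **`…_of_free`** /
  **`…_of_isDiscreteValuationRing`** — a `LevelData` whose finite–singular slot is the tame slot IS
  `IsFsAdmissible`, with NO further hypothesis under Howard's H.0 (`T` free), resp. over a DVR level
  ring with `ℓ + 1 ≠ 0`.
BSD is not proved by any of this.

References: B. Howard, Compositio Math. 140 (2004), §1.2, Def. 1.2.1–1.2.3 and Def. 1.1.8
(arXiv:1202.6340 pp. 5–7); J. Neukirch, *Algebraic Number Theory*, Ch. II Prop. (9.6).
-/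

set_option autoImplicit false

noncomputable section

open Function Field ValuativeRel NumberField IsDedekindDomain
open scoped Classical TensorProduct NumberField Pointwise

namespace Literature.NumberTheory.GaloisCohomology.Howard2004

open Literature.NumberTheory.GaloisRepresentations
open Literature.NumberTheory.GaloisRepresentations.DiscreteGaloisModule
open Literature.NumberTheory.GaloisRepresentations.IsNonarchimedeanLocalField
open Literature.NumberTheory.Automorphic

variable {K : Type} [Field K] [NumberField K] {M : Type} [AddCommGroup M] [TopologicalSpace M]
  [DiscreteTopology M] {R : Type} [CommRing R] [Module R M]
  {p : ℕ} {ρ : DiscreteGaloisModule K M} {t : SelmerTriple p ρ}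
  {N : Finset (HeightOneSpectrum (𝓞 K)) → Type} [∀ n, AddCommGroup (N n)]
  [∀ n, TopologicalSpace (N n)] [∀ n, DiscreteTopology (N n)] [∀ n, Module R (N n)]

/-! ## §1 `q_λ = ℓ²` and the torsion of `T/I_nT` at `λ ∈ n` -/

/-- At a degree-two prime, `q_λ = ℓ²` (in the `residueFieldCard` form of the local files).
[cite: Howard2004HeegnerKolyvagin, §1.2 (arXiv p. 6, L57–58: «degree two primes»)] -/
theorem residueFieldCard_eq_sq_of_isDegreeTwo {v : HeightOneSpectrum (𝓞 K)} (hv : IsDegreeTwo v) :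
    residueFieldCard (v.adicCompletion K) = residueChar v ^ 2 := by
  rw [residueFieldCard_adicCompletion_eq_natCard]; exact hv

/-- **`(q_λ − 1)·(T/I_nT) = 0` for `λ ∈ n ∈ 𝓝(𝓛)`** (`q_λ = ℓ²`, and `(ℓ² − 1)·(T/I_nT) = 0` by the
tree's `LevelData.residueChar_sq_sub_one_nsmul_eq_zero`): Howard's «`|k_vˣ|·T = 0`» of Def. 1.1.8 at
the module `T/I_nT`, in the `residueFieldCard` currency of `TamePin.fs`.
[cite: Howard2004HeegnerKolyvagin, Def. 1.1.8 and Def. 1.2.1 (arXiv p. 5 L144–146, p. 6 L63–75)] -/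
theorem residueFieldCard_sub_one_smul_eq_zero_of_mem_level (D : LevelData R ρ t N)
    {n : Finset (HeightOneSpectrum (𝓞 K))} (hn : n ∈ t.levelSet) {v : HeightOneSpectrum (𝓞 K)}
    (hv : v ∈ n) (x : N n) : (residueFieldCard (v.adicCompletion K) - 1) • x = 0 := by
  rw [residueFieldCard_eq_sq_of_isDegreeTwo (t.primes_subset (hn hv)).1]
  exact D.residueChar_sq_sub_one_nsmul_eq_zero hv x

/-- **`#G_ℓ·(T/I_nT) = 0` for `λ ∈ n ∈ 𝓝(𝓛)`** (`#G_ℓ = ℓ + 1` at a degree-two prime, and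
`(ℓ + 1)·(T/I_nT) = 0` by the tree's `LevelData.residueChar_add_one_nsmul_eq_zero`).
[cite: Howard2004HeegnerKolyvagin, Def. 1.2.1 (arXiv p. 6, L63–72)] -/
theorem natCard_gell_smul_eq_zero_of_mem_level (D : LevelData R ρ t N)
    {n : Finset (HeightOneSpectrum (𝓞 K))} (hn : n ∈ t.levelSet) {v : HeightOneSpectrum (𝓞 K)}
    (hv : v ∈ n) (x : N n) : Nat.card (Gell v) • x = 0 := by
  rw [natCard_gell_of_isDegreeTwo (t.primes_subset (hn hv)).1]
  exact D.residueChar_add_one_nsmul_eq_zero hv x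

/-! ## §2 `Γ_{K_λ}` acts trivially on `T/I_nT` at `λ ∈ n` -/

/-- **At `λ ∈ 𝓛`, if the Frobenius elements at `λ` act trivially on (the presentation of) `T/I_nT`,
then the whole local Galois group `Γ_{K_λ}` does** — Howard's «`G_{K_v}` acts trivially on `T`» of
Def. 1.1.8 for the module of Def. 1.2.3: the inertia group acts trivially because `T`, hence `T/I_nT`,
is unramified at `λ ∈ 𝓛 ⊆ 𝓛₀` (tree `LevelData.isUnramifiedAt_of_mem_primes`,
`GaloisRep.isUnramifiedAt_iff_toLocal_holds`); a local arithmetic Frobenius lift restricts to a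
Frobenius element at `λ` (tree `isArithFrobAt_absGaloisRestrict_adicCompletionPrime_iff`), which acts
trivially by `hFrob` (for `λ ∈ n`: `Frob_λ ≡ 1 mod I_ℓ ⊆ I_n`, tree `LevelData.ρq_apply_eq_self_of_h0`
/ `_of_free` / `_of_isDiscreteValuationRing`); and `I_{K_λ}·⟨Frob_λ⟩` is dense in `Γ_{K_λ}` while
stabilisers are closed.
[cite: Howard2004HeegnerKolyvagin, Def. 1.2.1 and Def. 1.2.3 (arXiv p. 6, L57–75 and L126–131)]
[cite: NeukirchANT1999, Ch. II §9 Prop. (9.6)] -/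
theorem trivial_toLocal_of_mem_primes (D : LevelData R ρ t N) {n : Finset (HeightOneSpectrum (𝓞 K))}
    {v : HeightOneSpectrum (𝓞 K)} (hvP : v ∈ t.primes)
    (hFrob : ∀ σ : absoluteGaloisGroup K, IsArithFrobAtPlace K v σ → ∀ x : N n, D.ρq n σ x = x)
    (σ : absoluteGaloisGroup (v.adicCompletion K)) (x : N n) :
    GaloisRep.toLocal v (D.ρq n) σ x = x := by
  -- the stabiliser of everything, a closed subgroup of `Γ_{K_λ}`
  let S : Subgroup (absoluteGaloisGroup (v.adicCompletion K)) :=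
    { carrier := {g | ∀ y : N n, GaloisRep.toLocal v (D.ρq n) g y = y}
      one_mem' := fun y => by simp
      mul_mem' := fun {a b} ha hb y => by
        rw [map_mul, Module.End.mul_apply, hb y, ha y]
      inv_mem' := fun {a} ha y => by
        calc GaloisRep.toLocal v (D.ρq n) a⁻¹ y
            = GaloisRep.toLocal v (D.ρq n) a (GaloisRep.toLocal v (D.ρq n) a⁻¹ y) := (ha _).symm
          _ = GaloisRep.toLocal v (D.ρq n) (a * a⁻¹) y := by rw [map_mul, Module.End.mul_apply]
          _ = y := by rw [mul_inv_cancel, map_one, Module.End.one_apply] }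
  have hS_closed : IsClosed (S : Set (absoluteGaloisGroup (v.adicCompletion K))) := by
    have : (S : Set (absoluteGaloisGroup (v.adicCompletion K))) =
        ⋂ y : N n, {g | GaloisRep.toLocal v (D.ρq n) g y = y} := by
      ext g; simp [S]
    rw [this]
    exact isClosed_iInter fun y =>
      isClosed_eq ((GaloisRep.toLocal v (D.ρq n)).continuous_apply_left y) continuous_const
  -- (a) inertia acts trivially: `T/I_nT` is unramified at `λ ∈ 𝓛`
  have hI : ∀ τ ∈ absInertia (v.adicCompletion K), τ ∈ S := by
    intro τ hτ y
    have h1 : GaloisRep.toLocal v (D.ρq n) τ = 1 :=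
      (GaloisRep.isUnramifiedAt_iff_toLocal_holds v (D.ρq n)).mp (D.isUnramifiedAt_of_mem_primes n hvP) τ hτ
    exact LinearMap.congr_fun h1 y
  -- (b) an arithmetic Frobenius lift acts trivially
  obtain ⟨φ, hφ⟩ := exists_isAbsArithFrob_holds (F := v.adicCompletion K)
  have hφ1 : IsFrobPow φ 1 := IsAbsArithFrob.isFrobPow_holds hφ
  have hF : IsArithFrobAtPlace K v (absGaloisRestrict K (v.adicCompletion K) φ) :=
    ⟨adicCompletionPrime K v, adicCompletionPrime_mem_primesAbove K v,
      (isArithFrobAt_absGaloisRestrict_adicCompletionPrime_iff K v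
        (residueFieldCard_adicCompletion_eq_natCard v) φ).mpr hφ⟩
  have hφS : φ ∈ S := fun y => hFrob _ hF y
  -- (c) density of `I_{K_λ}·⟨φ⟩`
  have hsub : (absInertia (v.adicCompletion K) : Set (absoluteGaloisGroup (v.adicCompletion K))) *
      (Subgroup.zpowers φ : Set (absoluteGaloisGroup (v.adicCompletion K))) ⊆ S := by
    rintro _ ⟨a, ha, b, hb, rfl⟩
    exact S.mul_mem (hI a ha) ((Subgroup.zpowers_le.mpr hφS) hb)
  have hall : (S : Set (absoluteGaloisGroup (v.adicCompletion K))) = Set.univ := by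
    have hd := (dense_absInertia_mul_zpowers_of_isFrobPow (v.adicCompletion K) hφ1).closure_eq
    rw [← Set.univ_subset_iff, ← hd]
    exact closure_minimal hsub hS_closed
  have hσ : σ ∈ S := by
    have : σ ∈ (S : Set (absoluteGaloisGroup (v.adicCompletion K))) := by rw [hall]; trivial
    exact this
  exact hσ x

/-- **At `λ ∈ n ∈ 𝓝(𝓛)`, `Γ_{K_λ}` acts trivially on `T/I_nT` under H.0** (`T` free of rank two:
`Frob_λ ≡ 1 (mod I_ℓ•T)`, `I_ℓ ⊆ I_n`, tree `LevelData.ρq_apply_eq_self_of_h0`).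
[cite: Howard2004HeegnerKolyvagin, Def. 1.2.1, Def. 1.2.3 and H.0 (arXiv p. 6 L57–75, p. 7 L57)] -/
theorem trivial_toLocal_of_mem_level_of_h0 (h0 : H0 R M) (D : LevelData R ρ t N)
    {n : Finset (HeightOneSpectrum (𝓞 K))} (hn : n ∈ t.levelSet) {v : HeightOneSpectrum (𝓞 K)}
    (hv : v ∈ n) (σ : absoluteGaloisGroup (v.adicCompletion K)) (x : N n) :
    GaloisRep.toLocal v (D.ρq n) σ x = x :=
  trivial_toLocal_of_mem_primes D (hn hv) (fun _ hσ y => D.ρq_apply_eq_self_of_h0 h0 hv hσ y) σ x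

/-- The hypotheses of the tame slot hold at every `λ ∈ n ∈ 𝓝(𝓛)`, given that the Frobenius
elements at `λ` act trivially on `T/I_nT`.
[cite: Howard2004HeegnerKolyvagin, Def. 1.1.8 / Def. 1.2.3 (arXiv p. 5 L144–146, p. 6 L126–131)] -/
theorem tameHyp_of_mem_level (D : LevelData R ρ t N) {n : Finset (HeightOneSpectrum (𝓞 K))}
    (hn : n ∈ t.levelSet) {v : HeightOneSpectrum (𝓞 K)} (hv : v ∈ n)
    (hFrob : ∀ σ : absoluteGaloisGroup K, IsArithFrobAtPlace K v σ → ∀ x : N n, D.ρq n σ x = x) :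
    TameHyp D.ρq n v :=
  ⟨trivial_toLocal_of_mem_primes D (hn hv) hFrob,
    residueFieldCard_sub_one_smul_eq_zero_of_mem_level D hn hv⟩

/-! ## §3 The tame slot is admissible -/

/-- **A `LevelData` whose finite–singular slot is the tame slot IS `IsFsAdmissible`**, given only
that the Frobenius elements at `λ` act trivially on `T/I_nT` for `λ ∈ n ∈ 𝓝(𝓛)` (the defining
property of `I_ℓ ⊆ I_n`; automatic under H.0, `…_of_h0`): Howard's finite–singular comparison map
(tame reading) is bijective on the finite classes and natural in the module at every `λ ∈ n ∈ 𝓝(𝓛)`.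
[cite: Howard2004HeegnerKolyvagin, Def. 1.1.8 and Def. 1.2.3 (arXiv p. 5 L144–149, p. 6 L126 – p. 7 L12)] -/
theorem LevelData.isFsAdmissible_of_fs_eq_tameSlot_of_frob [Fact p.Prime] [∀ n, Finite (N n)]
    (D : LevelData R ρ t N) (π : ∀ v : HeightOneSpectrum (𝓞 K), TamePin v)
    (hfs : D.fs = tameSlot π D.ρq)
    (hFrob : ∀ n ∈ t.levelSet, ∀ v ∈ n, ∀ σ : absoluteGaloisGroup K, IsArithFrobAtPlace K v σ →
      ∀ x : N n, D.ρq n σ x = x) :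
    D.IsFsAdmissible :=
  D.isFsAdmissible_of_fs_eq_tameSlot π hfs
    (fun _ hn _ hv => tameHyp_of_mem_level D hn hv (hFrob _ hn _ hv))
    fun _ hn _ hv => natCard_gell_smul_eq_zero_of_mem_level D hn hv

/-- **Under H.0 (`T` free of rank two over `R`), a `LevelData` with the tame slot is
`IsFsAdmissible`** — no further hypothesis (tree `LevelData.ρq_apply_eq_self_of_h0`).
[cite: Howard2004HeegnerKolyvagin, Def. 1.1.8, Def. 1.2.1–1.2.3 and H.0 (arXiv pp. 5–7)] -/
theorem LevelData.isFsAdmissible_of_fs_eq_tameSlot_of_h0 [Fact p.Prime] [∀ n, Finite (N n)]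
    (D : LevelData R ρ t N) (π : ∀ v : HeightOneSpectrum (𝓞 K), TamePin v)
    (hfs : D.fs = tameSlot π D.ρq) (h0 : H0 R M) : D.IsFsAdmissible :=
  D.isFsAdmissible_of_fs_eq_tameSlot_of_frob π hfs
    fun _ _ _ hv _ hσ x => D.ρq_apply_eq_self_of_h0 h0 hv hσ x

/-- **For `T` free over `R`, a `LevelData` with the tame slot is `IsFsAdmissible`.**
[cite: Howard2004HeegnerKolyvagin, Def. 1.1.8, Def. 1.2.1–1.2.3 and H.0 (arXiv pp. 5–7)] -/
theorem LevelData.isFsAdmissible_of_fs_eq_tameSlot_of_free [Fact p.Prime] [∀ n, Finite (N n)]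
    [Module.Free R M] (D : LevelData R ρ t N) (π : ∀ v : HeightOneSpectrum (𝓞 K), TamePin v)
    (hfs : D.fs = tameSlot π D.ρq) : D.IsFsAdmissible :=
  D.isFsAdmissible_of_fs_eq_tameSlot_of_frob π hfs
    fun _ _ _ hv _ hσ x => D.ρq_apply_eq_self_of_free hv hσ x

/-- **For `R` a discrete valuation ring with `ℓ + 1 ≠ 0` in `R` for `ℓ ∈ 𝓛` (e.g. the levels of a
DVR setting), ANY `T`: a `LevelData` with the tame slot is `IsFsAdmissible`**
(tree `LevelData.ρq_apply_eq_self_of_isDiscreteValuationRing`).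
[cite: Howard2004HeegnerKolyvagin, Def. 1.1.8, Def. 1.2.1–1.2.3 (arXiv pp. 5–7)] -/
theorem LevelData.isFsAdmissible_of_fs_eq_tameSlot_of_isDiscreteValuationRing [Fact p.Prime]
    [∀ n, Finite (N n)] [IsDomain R] [IsDiscreteValuationRing R]
    (D : LevelData R ρ t N) (π : ∀ v : HeightOneSpectrum (𝓞 K), TamePin v)
    (hfs : D.fs = tameSlot π D.ρq) (hℓ : ∀ v ∈ t.primes, ((residueChar v + 1 : ℕ) : R) ≠ 0) :
    D.IsFsAdmissible :=
  D.isFsAdmissible_of_fs_eq_tameSlot_of_frob π hfs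
    fun _ hn _ hv _ hσ x => D.ρq_apply_eq_self_of_isDiscreteValuationRing hv (hℓ _ (hn hv)) hσ x

end Literature.NumberTheory.GaloisCohomology.Howard2004

end
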